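import Summits.ValiantsHypothesis.ValiantsHypothesis.Theorems.BarrierLeverChowBenchmarkPairsDirichletSplit

/-!
# Route BarrierLever — item 22038 `ChowBenchmarkPairs`, line `moore-peel`: the ROW–WINDOW DUALITY of the Dirichlet
# window minors, `det d(c,i)(x) = ± det d(i,c)(−x)`

Helper file (`--supports stmt-ValiantsHypothesis-22038`; cell valiant-natproofs, rung V4, 𝒟-side benchmark of
record, line `moore_peel`; seat val-np-p4 gen 27, memo `HOME/val-np-p4/g27/MEMO-valnp4-g27.md` §0 «duality»).  Closes
NO item.  No new definitions.

* `wrootsAux_swap` / **`wroots_swap`**: exchanging the number of rows `i` and the window start `c` NEGATES the root list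
  of THEOREM W: `wroots c i = (wroots i c).map (-·)` — rule (R1) for `(i,c)` is rule (R3) for `(c,i)` and (R2) is
  self-dual (a finite case analysis on the three-rule recursion).
* **`det_dirichletWindow_dual`**: `det d(c,i)(x) = ± det d(i,c)(-x)` over any commutative ring (the window with `c` rows
  starting at code `i` against the window with `i` rows starting at code `c`).  On paper this is Jacobi's
  complementary-minor identity for the unipotent Dirichlet zeta matrix plus two complementations; here it falls out of
  THEOREM W.

WHAT THIS IS NOT: nothing on the segment-mean stub, on crux stmt-ValiantsHypothesis-14610 or on `VP` versus `VNP`.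
-/

set_option linter.dupNamespace false

namespace Summit.ValiantsHypothesis.ValiantsHypothesis.Theorems.BarrierLever.MoorePeel

open Finset Matrix

variable {R : Type*} [CommRing R]

/-! ## 1. Duality of the root lists -/

/-- Negating a shifted list. -/
theorem map_neg_map_add_one (l : List ℤ) : (l.map (· + 1)).map (fun t : ℤ => -t) = (l.map (fun t : ℤ => -t)).map (· - 1) := by
  simp only [List.map_map]
  refine List.map_congr_left fun t _ => ?_
  simp only [Function.comp_apply]; ring

/-- Negating a shifted list. -/
theorem map_neg_map_sub_one (l : List ℤ) : (l.map (· - 1)).map (fun t : ℤ => -t) = (l.map (fun t : ℤ => -t)).map (· + 1) := by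
  simp only [List.map_map]
  refine List.map_congr_left fun t _ => ?_
  simp only [Function.comp_apply]; ring

/-- Negating a list of zeros. -/
theorem map_neg_replicate_zero (n : ℕ) : (List.replicate n (0 : ℤ)).map (fun t : ℤ => -t) = List.replicate n 0 := by
  simp [List.map_replicate]

/-- No rows: empty root list. -/
theorem wrootsAux_zero_left (f c : ℕ) : wrootsAux f 0 c = [] := by
  cases f <;> simp [wrootsAux]

/-- Window start `0`: empty root list. -/
theorem wrootsAux_zero_right (f i : ℕ) : wrootsAux f i 0 = [] := by
  cases f <;> simp [wrootsAux]

/-- **Duality of the root lists**: `wrootsAux f c i = -(wrootsAux f i c)`. -/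
theorem wrootsAux_swap (f : ℕ) : ∀ i c : ℕ, wrootsAux f c i = (wrootsAux f i c).map (fun t : ℤ => -t) := by
  induction f with
  | zero => intro i c; simp [wrootsAux]
  | succ f ih =>
    intro i c
    rw [wrootsAux, wrootsAux]
    by_cases h0 : i = 0 ∨ c = 0
    · rw [if_pos h0, if_pos (Or.comm.mp h0)]; simp
    rw [if_neg h0, if_neg (fun h => h0 (Or.comm.mp h))]
    obtain ⟨hi0, hc0⟩ := not_or.mp h0
    rw [show i + c - 1 = c + i - 1 by omega]
    set P := topPow (c + i - 1) with hP
    have hspec := topPow_spec (m := c + i - 1) (by omega)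
    rw [← hP] at hspec
    -- the right-hand side: the three rules for `(i, c)`
    by_cases h1 : P ≤ c
    · rw [if_pos h1, List.map_append, map_neg_replicate_zero, map_neg_map_add_one, ← ih i (c - P)]
      -- left-hand side `(c, i)`: `i ≤ P`; (R1) only if `i = P` (then also `c = P`), (R2) if `c = P`, else (R3)
      by_cases hPi : P ≤ i
      · rw [if_pos hPi, show i - P = 0 by omega, show c - P = 0 by omega, wrootsAux_zero_right,
          wrootsAux_zero_left, show c = i by omega]
        simp
      rw [if_neg hPi]
      by_cases hcP : c ≤ P
      · rw [if_pos hcP, show i + c - P = i by omega, show P - c = 0 by omega, show c - P = 0 by omega,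
          wrootsAux_zero_right, wrootsAux_zero_left]
        simp
      · rw [if_neg hcP]
    rw [if_neg h1]
    by_cases h2 : i ≤ P
    · rw [if_pos h2, List.map_append, map_neg_replicate_zero, ← ih (P - c) (P - i)]
      -- left-hand side: (R1) if `i = P`, else (R2)
      by_cases hPi : P ≤ i
      · rw [if_pos hPi, show i - P = 0 by omega, show P - i = 0 by omega, show c + i - P = c by omega,
          wrootsAux_zero_right, wrootsAux_zero_left]
        simp
      · rw [if_neg hPi, if_pos (by omega), show i + c - P = c + i - P by omega]
    · -- (R3) for `(i, c)`: (R1) for `(c, i)`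
      rw [if_neg h2, List.map_append, map_neg_replicate_zero, map_neg_map_sub_one, ← ih (i - P) c,
        if_pos (by omega)]

/-- **Duality of the root lists**: `wroots c i = -(wroots i c)`. -/
theorem wroots_swap (i c : ℕ) : wroots c i = (wroots i c).map (fun t : ℤ => -t) := by
  rw [wroots, wroots, Nat.add_comm c i, wrootsAux_swap]

/-! ## 2. Duality of the determinants -/

/-- `∏_{t ∈ -l} (x + t) = (-1)^{|l|} ∏_{t ∈ l} (-x + t)`. -/
theorem wprod_map_neg (x : R) (l : List ℤ) :
    wprod x (l.map (fun t : ℤ => -t)) = (-1) ^ l.length * wprod (-x) l := by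
  induction l with
  | nil => simp
  | cons t l ih =>
    simp only [wprod, List.map_cons, List.prod_cons, List.length_cons] at ih ⊢
    rw [ih, pow_succ]
    push_cast
    ring

/-- Signs `(-1)^n` as units. -/
theorem exists_unit_eq_neg_one_pow (n : ℕ) : ∃ η : ℤˣ, ((η : ℤ) : R) = (-1) ^ n := by
  induction n with
  | zero => exact ⟨1, by simp⟩
  | succ n ih =>
    obtain ⟨η, hη⟩ := ih
    exact ⟨-η, by rw [Units.val_neg, Int.cast_neg, hη, pow_succ]; ring⟩

/-- **Row–window duality**: `det d(c,i)(x) = ± det d(i,c)(-x)`. -/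
theorem det_dirichletWindow_dual (x : R) (i c : ℕ) :
    ∃ ε : ℤˣ, (dirichletWindow x c i).det = ((ε : ℤ) : R) * (dirichletWindow (-x) i c).det := by
  obtain ⟨ε₁, h₁⟩ := det_dirichletWindow_eq_prod x c i
  obtain ⟨ε₂, h₂⟩ := det_dirichletWindow_eq_prod (-x) i c
  have hε₂ : ((ε₂ : ℤ) : R) * ((ε₂ : ℤ) : R) = 1 := by
    rw [← Int.cast_mul, ← Units.val_mul, Int.units_mul_self, Units.val_one, Int.cast_one]
  obtain ⟨η, hη⟩ := exists_unit_eq_neg_one_pow (R := R) (wroots i c).length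
  refine ⟨ε₁ * η * ε₂, ?_⟩
  rw [h₁, wroots_swap, wprod_map_neg, units_cast_mul, units_cast_mul, hη]
  calc ((ε₁ : ℤ) : R) * ((-1) ^ (wroots i c).length * wprod (-x) (wroots i c))
      = ((ε₁ : ℤ) : R) * (-1) ^ (wroots i c).length * ((((ε₂ : ℤ) : R) * ((ε₂ : ℤ) : R)) *
          wprod (-x) (wroots i c)) := by rw [hε₂, one_mul, mul_assoc]
    _ = ((ε₁ : ℤ) : R) * (-1) ^ (wroots i c).length * ((ε₂ : ℤ) : R) *
          (((ε₂ : ℤ) : R) * wprod (-x) (wroots i c)) := by ring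
    _ = ((ε₁ : ℤ) : R) * (-1) ^ (wroots i c).length * ((ε₂ : ℤ) : R) * (dirichletWindow (-x) i c).det := by
          rw [← h₂]

/-- In particular the generic stage determinant with `c` rows at window start `i` has the NEGATED roots: e.g. the
windows `(1, c)` and `(c, 1)`: `det d(c, 1)(x) = ± x^{(|bits c|)}` evaluated at `-x` up to sign. -/
theorem det_dirichletWindow_dual_X (i c : ℕ) : ∃ ε : ℤˣ,
    (dirichletWindow (Polynomial.X : Polynomial ℤ) c i).det =
      ((ε : ℤ) : Polynomial ℤ) * (dirichletWindow (-Polynomial.X : Polynomial ℤ) i c).det :=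
  det_dirichletWindow_dual Polynomial.X i c

end Summit.ValiantsHypothesis.ValiantsHypothesis.Theorems.BarrierLever.MoorePeel
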